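import Summits.CriticalPhenomena.CardyFormulaZ2.Theorems.CardyComplexConeParafermionToSLESixFamiliesDiamondTraceStart
import HarnessLib

/-!
# Colour propagation along out-edge paths from the start edge
# (line `potential-darboux-picard-diamond`, S1p `stub_boundaryDartPhase`, part 12)

Crux `ParafermionToSLESixFamilies` (stmt-CriticalPhenomena-11389), line `potential-darboux-picard-diamond`, stub
`stub_boundaryDartPhase` (S1p). The last ingredient of `BoundaryDartPhase` is the position of the start edge
`e_a = {x₀, x₀ + u_{k₀}}` (`x₀ ∈ A`, `b₀ = x₀ + u_{k₀} ∈ B`, the edge SOURCED at `x₀`: inner face on the left of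
`x₀ → b₀`) relative to the continuum marks. Its lattice half is a colour-propagation principle for admissible data whose
`A`–`B` edges are `e_a` and one other edge `e_b` (there are exactly two): along a lattice path `P 0 = b₀, P 1, …, P L`
of OUT-EDGES (`P (i+1) = P i + u_d` with the edge sourced at `P i`), without repeated site and avoiding `e_b`, every
site is on `B` (`forall_mem_zdArcB_of_outPath`, registered): a colour switch along the path is an `A`–`B` edge, hence
`e_a`, hence the path would return to `b₀` and leave it towards `x₀` along an out-edge `b₀ → x₀` — but `e_a` is sourced
at `x₀`, not at `b₀`. Dually, along a path of IN-EDGES from `x₀` (`P (i+1) = P i + u_d` with the edge sourced at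
`P (i+1)`) every site is on `A` (`forall_mem_zdArcA_of_inPath`). Out-edge paths run counter-clockwise along the discrete
boundary (domain on the left), in-edge paths clockwise.
-/

noncomputable section

namespace Summit.CriticalPhenomena.CardyFormulaZ2.Cruxes.ParafermionToSLESixFamilies.PotentialDarbouxPicardDiamond

open Literature.Probability Literature.Probability.LatticeModels Literature.Probability.Percolation
open Literature.Probability.LatticeModels.DiscreteDobrushin

/-- An out-edge with its `A`-source and `B`-target... more generally: a sourced face-boundary edge with one endpoint on
`A` and the other on `B` is an `A`–`B` edge. -/
theorem mem_zdABEdges_of_isOutEdge {E : DiscreteDobrushin} {x : Site 2} {d : Fin 4} (h : E.IsOutEdge x d)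
    (hAB : (x ∈ E.zdArcA ∧ x + cornerUnit d ∈ E.zdArcB) ∨ (x ∈ E.zdArcB ∧ x + cornerUnit d ∈ E.zdArcA)) :
    s(x, x + cornerUnit d) ∈ E.zdABEdges := by
  refine ⟨h.isFaceBoundaryEdge.1, ?_, ?_⟩
  · rcases hAB with ⟨hx, -⟩ | ⟨-, hy⟩
    · exact ⟨x, Sym2.mem_mk_left _ _, hx⟩
    · exact ⟨_, Sym2.mem_mk_right _ _, hy⟩
  · rcases hAB with ⟨-, hy⟩ | ⟨hx, -⟩
    · exact ⟨_, Sym2.mem_mk_right _ _, hy⟩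
    · exact ⟨x, Sym2.mem_mk_left _ _, hx⟩

/-- **The start edge is not sourced at its `B`-end.** -/
theorem not_isOutEdge_bEnd {E : DiscreteDobrushin} (hE : E.IsZdAdmissible) {d : Fin 4}
    (hd : (startCorner hE).1 + cornerUnit (startCorner hE).2 + cornerUnit d = (startCorner hE).1) :
    ¬ E.IsOutEdge ((startCorner hE).1 + cornerUnit (startCorner hE).2) d := by
  have hsc := isStartCorner_startCorner hE
  intro h
  have hd' : d = (startCorner hE).2 + 2 := by
    apply cornerUnit_injective
    rw [cornerUnit_add_two, eq_neg_iff_add_eq_zero, add_comm]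
    have := congrArg (fun w => w - (startCorner hE).1) hd
    simpa [add_assoc] using this
  subst hd'
  rw [isOutEdge_iff_isInEdge, fin4_add_two_add_two', add_assoc, cornerUnit_add_two, add_neg_cancel, add_zero] at h
  exact hsc.isOutEdge.not_isInEdge h

/-- **Colour propagation along an out-edge path from the `B`-end of the start edge** (registered helper of
`stub_boundaryDartPhase`). See the module docstring. -/
theorem forall_mem_zdArcB_of_outPath : ∀ (E : DiscreteDobrushin) (hE : E.IsZdAdmissible) (eb : Sym2 (Site 2)), (∀ e ∈ E.zdABEdges, e = cSrc (startCorner hE) ∨ e = eb) → ∀ (P : ℕ → Site 2) (L : ℕ), P 0 = (startCorner hE).1 + cornerUnit (startCorner hE).2 → (∀ i : ℕ, i < L → ∃ d : Fin 4, P (i + 1) = P i + cornerUnit d ∧ E.IsOutEdge (P i) d) → (∀ i j : ℕ, i ≤ L → j ≤ L → P i = P j → i = j) → (∀ i : ℕ, i < L → s(P i, P (i + 1)) ≠ eb) → ∀ i : ℕ, i ≤ L → P i ∈ E.zdArcB := by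
  intro E hE eb hAB P L hP0 hstep hinj heb
  have hsc := isStartCorner_startCorner hE
  intro i
  induction i with
  | zero => intro _; rw [hP0]; exact hsc.mem_zdArcB
  | succ i ih =>
    intro hi
    have hiL : i < L := Nat.lt_of_succ_le hi
    have hB : P i ∈ E.zdArcB := ih hiL.le
    obtain ⟨d, hPd, hout⟩ := hstep i hiL
    -- the next site is a discrete-boundary site
    have hbd : P (i + 1) ∈ E.zdBoundary := by
      rw [hPd]; exact mem_zdBoundary_of_isInEdge ((isOutEdge_iff_isInEdge _ _).1 hout)
    rcases hE.zdBoundary_subset hbd with hA | hB'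
    · -- a switch: the edge is an `A`–`B` edge, hence the start edge
      exfalso
      have hmem : s(P i, P (i + 1)) ∈ E.zdABEdges := by
        rw [hPd]; exact mem_zdABEdges_of_isOutEdge hout (Or.inr ⟨hB, hPd ▸ hA⟩)
      rcases hAB _ hmem with h | h
      · rw [cSrc, Sym2.eq_iff] at h
        rcases h with ⟨h1, -⟩ | ⟨h1, h2⟩
        · exact Set.disjoint_left.1 hE.disjoint hsc.mem_zdArcA (h1 ▸ hB)
        · -- the path returns to `b₀` and leaves it along an out-edge towards `x₀`
          have hi0 : i = 0 := hinj i 0 hiL.le (Nat.zero_le _) (h1.trans hP0.symm)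
          subst hi0
          rw [hP0] at hPd hout
          exact not_isOutEdge_bEnd hE (hPd.symm.trans h2) hout
      · exact heb i hiL h
    · exact hB'

/-- **Colour propagation along an in-edge path from the `A`-end of the start edge.** -/
theorem forall_mem_zdArcA_of_inPath {E : DiscreteDobrushin} (hE : E.IsZdAdmissible) {eb : Sym2 (Site 2)}
    (hAB : ∀ e ∈ E.zdABEdges, e = cSrc (startCorner hE) ∨ e = eb) (P : ℕ → Site 2) (L : ℕ) (hP0 : P 0 = (startCorner hE).1)
    (hstep : ∀ i : ℕ, i < L → ∃ d : Fin 4, P (i + 1) = P i + cornerUnit d ∧ E.IsOutEdge (P (i + 1)) (d + 2))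
    (hinj : ∀ i j : ℕ, i ≤ L → j ≤ L → P i = P j → i = j) (heb : ∀ i : ℕ, i < L → s(P i, P (i + 1)) ≠ eb) :
    ∀ i : ℕ, i ≤ L → P i ∈ E.zdArcA := by
  have hsc := isStartCorner_startCorner hE
  intro i
  induction i with
  | zero => intro _; rw [hP0]; exact hsc.mem_zdArcA
  | succ i ih =>
    intro hi
    have hiL : i < L := Nat.lt_of_succ_le hi
    have hA : P i ∈ E.zdArcA := ih hiL.le
    obtain ⟨d, hPd, hout⟩ := hstep i hiL
    have hback : P (i + 1) + cornerUnit (d + 2) = P i := by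
      rw [hPd, add_assoc, cornerUnit_add_two, add_neg_cancel, add_zero]
    have hbd : P (i + 1) ∈ E.zdBoundary := mem_zdBoundary_of_isOutEdge hout
    rcases hE.zdBoundary_subset hbd with hA' | hB
    · exact hA'
    · exfalso
      have hmem : s(P i, P (i + 1)) ∈ E.zdABEdges := by
        have := mem_zdABEdges_of_isOutEdge hout (Or.inr ⟨hB, hback.symm ▸ hA⟩)
        rwa [hback, Sym2.eq_swap] at this
      rcases hAB _ hmem with h | h
      · rw [cSrc, Sym2.eq_iff] at h
        rcases h with ⟨h1, h2⟩ | ⟨-, h2⟩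
        · -- the path leaves `x₀` towards `b₀` along an edge sourced at `b₀`
          have hi0 : i = 0 := hinj i 0 hiL.le (Nat.zero_le _) (h1.trans hP0.symm)
          subst hi0
          rw [h2] at hout hback
          rw [h1] at hback
          exact not_isOutEdge_bEnd hE hback hout
        · exact Set.disjoint_left.1 hE.disjoint hsc.mem_zdArcA (h2 ▸ hB)
      · exact heb i hiL h

end Summit.CriticalPhenomena.CardyFormulaZ2.Cruxes.ParafermionToSLESixFamilies.PotentialDarbouxPicardDiamond

end
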